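import Summits.QuantumFields.BalabanUV.Beta.FP.TorusCompositeCovarianceTwo
import Summits.QuantumFields.BalabanUV.Beta.FP.TorusCompositeCovarianceOneRows

/-!
# `BalabanUV.Beta.FP.TorusCompositeCovarianceTwoRows` — road «FP» for binder row D1, ROUTE T, the OWNER d1-p3's SPEC-27 «THE (j, m) TORUS CALL FOR m ≥ 2»,
# **(COV-m) ORDER 2 AT EVERY DEPTH, PART 3 — THE DOOR's ROWS `c2` AND `d2`** of the composite torus call `FP/NestedStepLawTorusCompositeOneShotTop` (#21): with
# `Q₁₂ := c² • compIns₂ Lc M′ lev rs (n+1) h` (PART 2's ♭ chain-rule second jet), `Q₁₁ := c • compIns₁ …` (C2), the door's `W₀ = towerGen`, `W₁ W₂` VERBATIM (`hW₁ hW₂`, weight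
# `c·h`), **`Q₁₂·W₀ + 2•(Q₁₁·W₁) + Q₁₀·W₂ = fromCols D̄₂ 0`** with the coarse jet **`D̄₂(a, t̄) = (c²·σ_{n+1}⁻¹)·((compRows … (n+1)·h) a)²·[t̄ = a.1 + e_{a.2}]`** — the PURE SQUARE of
# `D̄₁`'s transported direction, tip-type on every top bond (leaf-06's `CoarseFPExponential.torus_uTop_of_sq_on_comb` shape) — and **`Q₂₂·(σ_{n+1}•D̄) + 2•(Q₂₁·D̄₁) + Q₂₀·D̄₂ = 0`**
# (#21's `d2` AS DISPLAYED, on `Res`) with `Q₂₂ := c_{lev 0} •` the top step's ♭ bi-member along the direction transported one level up `(c·θ_{n+1})•(compRows·h)` (C2's `Q₂₁` weight)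

WHAT.  §1 `W₂_eq_smul_tip_mul_evalN` (the door's `W₂` is `c² •` the squared-weight tip contact times leaf-06's point-evaluation matrix) and **`torus_c2_tower`**: PART 2's
all-columns law `compIns₂_mul_tgrad` read through `towerGen = D_finest·evalN` (C2 §1): the tip terms are `−2•Q₁₁·W₁ − Q₁₀·W₂` (`evalN_congr`), the far-root term's top block is
`D̄₂` (`quo_itRoot`), its lower blocks VANISH (`evalN_itRoot_rootPt`) — #21's `c2` BY TERM after `rw [hQ₁₂, hQ₁₁]`.  §2 `pair_mul_tgrad_res_apply` ∕ `bimember_res_algebra` ∕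
**`bimember_mul_tgrad_res`** (the top step's weighted ♭ bi-member against the top comb's RESIDUAL gauge columns in ANY multiplier presentation `(pμ′, mμ′)` is `2 •` the weighted
first-order members on the tip contact `− c_ℓ •` the averaging rows on the squared-weight tip contact — PART 1's law with the far root off the residual columns, g17's
`tdelta_far_eq_zero_of_not_root` ∕ `perZ_bhKStepAt_inr_inl_of_proj_ne`), **`torus_d2_tower`** — #21's `d2` BY TERM after `rw [hQ₂₂, hQ₂₁]`, `Dbar := σ_{n+1} • D̄` as in `c0`
(the two `2•` tip terms cancel by `c_{lev 0}·σ·θ = 1`, the two squared-weight terms by `c_{lev 0}²·σ·(cθ)² = c²σ⁻¹`).  At `n = 0` these are the (STEP) door's rows with U23♭'s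
one-summand `Q₂₂` in the rooted presentation.  [folklore] finite sums BY NAME; no `def`, no `def … : Prop`, nothing cited, 0 sorry.  Nothing of the dictionary ∕ Bałaban's
asserted (the identification of `compIns₂` with Bałaban's composite second jet, and the ♭ label, are an2's TABLE word ∕ PART THREE's junction, R-D1-g44-3; filed AS
CANDIDATE, R-FP-63 (v)); `t2` (leaf-06) and `uTop` (its square-law producer) are NOT here.

HONEST DEPENDENCY (page 1, mandatory): continuum YM on T⁴ ⇐ BetaPertH ∧ nine spine estimates (0/9 proved); BetaPertH ⇐ (D1) ∧ (D4) ∧ CAP+tail;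
G-an2-4 gates asym, D1 and NE2/3/4.  HONEST FRAMING (cell contract, verbatim): «discharging `BetaPertH` makes Bałaban's UV stability UNCONDITIONAL —
a real constructive-QFT result; it is NOT the continuum limit and NOT the Clay problem.»  ABSOLUTE RULE (cell charter, verbatim): «No internally-minted
statement may enter as a cited fact. Every hypothesis is either kernel-proved in this package or a verbatim quotation of a PUBLISHED theorem with page
reference. The manuscript(s) under audit are NOT citable for their own disputed steps — they are the thing under adjudication; programme-internal
(2001/route/tribunal) claims are never citable.»  0 estimates; 0∕4 row-D1 binders; NOT (T-ID), NOT SDF, NOT D1, NOT BetaPertH, NOT continuum, NOT Clay.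
D1 formalisation swarm LEAF PROVER 02 (b2b-balaban-beta-d1-formalise-leaf-02 gen 25), 2026-08-23.  No existing file touched.
-/

noncomputable section

open scoped BigOperators

namespace Summit.QuantumFields.BalabanUV.Beta.FP.TorusCompositeCovarianceTwoRows

open Matrix Finset
open Literature.Probability.LatticeModels (Torus.proj)
open Literature.MathematicalPhysics.QuantumFieldTheory
open Literature.MathematicalPhysics.QuantumFieldTheory.Balaban1983to89
open Literature.MathematicalPhysics.QuantumFieldTheory.Balaban1983to89.Beta
open ExpKernelCalculus (MKer)
open B5Prop11Plancherel (fine)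
open B6Lemma24Torus (pbox mem_pbox)
open AffineAveraging (Site box toSite unitVec)
open LatticeForm (quo)
open AveragingHessianKernelsRooted (vhSAt)
open AveragingMixedJetTables (vh₂SAt)
open OneStepResolventKernel (Fib)
open B4TorusKernel.MultiPeriod (translate)
open Summit.QuantumFields.BalabanUV.Beta.BorderedHessian (bhKStepAt stepScale stepScale_ne_zero)
open Summit.QuantumFields.BalabanUV.Beta.FP.KernelPeriodisationFib (Idx perF perF_apply)
open Summit.QuantumFields.BalabanUV.Beta.FP.KernelPeriodisationFibLoc (dper)
open Summit.QuantumFields.BalabanUV.Beta.FP.TorusGaugeCovariance (tdelta tgrad)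
open Summit.QuantumFields.BalabanUV.Beta.FP.TorusGaugeCovariancePairing (wrapPt wrapPt_of_mem)
open Summit.QuantumFields.BalabanUV.Beta.FP.TorusGaugeCovarianceCoarse (coarsePt)
open Summit.QuantumFields.BalabanUV.Beta.FP.TorusCombRows (Res ne_rootOf_iff_proj_ne)
open Summit.QuantumFields.BalabanUV.Beta.GAN24.FineReadoutCauchyFrame (toSite_mem_range)
open Summit.QuantumFields.BalabanUV.Beta.FP.PeriodisedBorderWardContact (tdelta_far_eq_zero_of_not_root perZ_bhKStepAt_inr_inl_of_proj_ne)
open Summit.QuantumFields.BalabanUV.Beta.FP.PeriodisedBorderWardContactTwo (submatrix_borderT2_mul_tgrad)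
open Summit.QuantumFields.BalabanUV.Beta.FP.TorusCompositeObjects
open Summit.QuantumFields.BalabanUV.Beta.FP.TorusCompositeFP (evalN evalN_succ)
open Summit.QuantumFields.BalabanUV.Beta.FP.TorusCompositeCovariance (rootPt itRoot itRoot_succ quo_itRoot)
open Summit.QuantumFields.BalabanUV.Beta.FP.TorusCompositeCovarianceOne (tdelta_wrapPt of_tdelta_mul compIns₁ prod_stepScale_mul_card_ne_zero')
open Summit.QuantumFields.BalabanUV.Beta.FP.TorusCompositeCovarianceOneRows (towerGen_eq_tgrad_mul_evalN evalN_congr evalN_itRoot_rootPt W₁_eq_neg_smul_tip_mul_evalN)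
open Summit.QuantumFields.BalabanUV.Beta.FP.TorusCompositeCovarianceTwoStep (ite_bond_eq)
open Summit.QuantumFields.BalabanUV.Beta.FP.TorusCompositeCovarianceTwo (compIns₂ compIns₂_mul_tgrad)

variable {d : ℕ} (Lc : ℕ) [NeZero Lc]

/-! ## §1 The door's composite covariance row `c2` -/

section RowC2

variable (M' : Fin (d + 1) → ℕ) [∀ μ, NeZero (M' μ)] (lev : ℕ → ℕ) (rs : ℕ → (Fin (d + 1) → ℕ))

/-- [folklore] the door's generator second jet `W₂` (leaf-06's `evalN` at the TIPS, weight `(c·h)²`) is `c² •` the squared-weight tip-contact matrix times the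
point-evaluation matrix at the finest sites (`of_tdelta_mul`, `evalN_congr` along `wrapPt`). -/
theorem W₂_eq_smul_tip_mul_evalN (n : ℕ) (c : ℝ) (h : ↥(pbox (towerTorus Lc M' (n + 1))) × Fin (d + 1) → ℝ) :
    (Matrix.of fun (b : (↥(pbox (towerTorus Lc M' (n + 1))) × Fin (d + 1))) (e : NParam Lc M' rs (n + 1)) =>
        (c * h b) ^ 2 * evalN Lc M' rs (n + 1) (fun b' : (↥(pbox (towerTorus Lc M' (n + 1))) × Fin (d + 1)) => (b'.1 : Site (d + 1)) + unitVec b'.2) b e)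
      = c ^ 2 • (Matrix.of (fun (b : ↥(pbox (towerTorus Lc M' (n + 1))) × Fin (d + 1)) (s : ↥(pbox (towerTorus Lc M' (n + 1)))) =>
            (h b * h b) * tdelta (towerTorus Lc M' (n + 1)) ((b.1 : Site (d + 1)) + unitVec b.2) s)
          * evalN Lc M' rs (n + 1) (fun s : ↥(pbox (towerTorus Lc M' (n + 1))) => (s : Site (d + 1)))) := by
  rw [of_tdelta_mul]
  ext b e
  simp only [Matrix.of_apply, Matrix.smul_apply, smul_eq_mul]
  rw [evalN_congr Lc (n + 1) M' rs (fun b' : (↥(pbox (towerTorus Lc M' (n + 1))) × Fin (d + 1)) => (b'.1 : Site (d + 1)) + unitVec b'.2)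
    (fun s : ↥(pbox (towerTorus Lc M' (n + 1))) => (s : Site (d + 1))) b (wrapPt (towerTorus Lc M' (n + 1)) ((b.1 : Site (d + 1)) + unitVec b.2))
    (fun i => B6Lemma24Torus.isPeriod_sub_wrap (M := towerTorus Lc M' (n + 1)) _ i) e]
  ring

/-- [folklore] **`torus_c2_tower` — (COV-m) ORDER 2: THE DOOR's COMPOSITE COVARIANCE ROW `c2` AT EVERY DEPTH.**  With `Q₁₂ := c² • compIns₂ Lc M′ lev rs (n+1) h` (PART 2's ♭
chain-rule second jet of the composite averaging along `h`), `Q₁₁ := c • compIns₁ …` (C2), `W₀ := towerGen …`, `W₁ W₂` the door's `hW₁ hW₂` VERBATIM (weight `c`):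
`Q₁₂·W₀ + 2•(Q₁₁·W₁) + Q₁₀·W₂ = fromCols D̄₂ 0`, `D̄₂(a, t̄) = (c²·σ_{n+1}⁻¹)·((compRows … (n+1)·h) a)²·[t̄ = a.1 + e_{a.2}]` — the composite second jet's coarse image is the
PURE-SQUARE tip-type jet of the transported direction on EVERY top bond, and every lower generator is killed.  Proof: PART 2's all-columns law through `towerGen = D·evalN`;
tip terms `= −2•Q₁₁·W₁ − Q₁₀·W₂`; far-root term: top block by `quo_itRoot`, lower blocks by `evalN_itRoot_rootPt`. -/
theorem torus_c2_tower (hrs : ∀ k, rs k ∈ box (d + 1) Lc) (n : ℕ) (c : ℝ) (h : ↥(pbox (towerTorus Lc M' (n + 1))) × Fin (d + 1) → ℝ)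
    {W₁ W₂ : Matrix (↥(pbox (towerTorus Lc M' (n + 1))) × Fin (d + 1)) (NParam Lc M' rs (n + 1)) ℝ}
    (hW₁ : W₁ = Matrix.of fun (b : (↥(pbox (towerTorus Lc M' (n + 1))) × Fin (d + 1))) (e : NParam Lc M' rs (n + 1)) =>
      -(c * h b * evalN Lc M' rs (n + 1) (fun b' : (↥(pbox (towerTorus Lc M' (n + 1))) × Fin (d + 1)) => (b'.1 : Site (d + 1)) + unitVec b'.2) b e))
    (hW₂ : W₂ = Matrix.of fun (b : (↥(pbox (towerTorus Lc M' (n + 1))) × Fin (d + 1))) (e : NParam Lc M' rs (n + 1)) =>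
      (c * h b) ^ 2 * evalN Lc M' rs (n + 1) (fun b' : (↥(pbox (towerTorus Lc M' (n + 1))) × Fin (d + 1)) => (b'.1 : Site (d + 1)) + unitVec b'.2) b e) :
    c ^ 2 • compIns₂ Lc M' lev rs (n + 1) h * towerGen Lc M' rs (n + 1) + (2 : ℝ) • (c • compIns₁ Lc M' lev rs (n + 1) h * W₁) + compRows Lc M' lev rs (n + 1) * W₂
      = Matrix.fromCols
          (Matrix.of fun (a : ↥(pbox M') × Fin (d + 1)) (t : Res (toSite (rs 0)) Lc M') =>
            (c ^ 2 * (∏ i ∈ range (n + 1), (stepScale d Lc (lev (i + 1)) * ((box (d + 1) Lc).card : ℝ)))⁻¹)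
              * ((compRows Lc M' lev rs (n + 1) *ᵥ h) a) ^ 2 * tdelta M' ((a.1 : Site (d + 1)) + unitVec a.2) t.1)
          (0 : Matrix (↥(pbox M') × Fin (d + 1)) (NParam Lc (fine Lc M') (fun k => rs (k + 1)) n) ℝ) := by
  -- the far-root contact through the point-evaluation matrix, weighted by `c²·σ⁻¹`: top block = the coarse jet, lower blocks vanish
  have hfar : (c ^ 2 * (∏ i ∈ range (n + 1), (stepScale d Lc (lev (i + 1)) * ((box (d + 1) Lc).card : ℝ)))⁻¹) •
        (Matrix.of (fun (a : ↥(pbox M') × Fin (d + 1)) (s : ↥(pbox (towerTorus Lc M' (n + 1)))) =>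
          ((compRows Lc M' lev rs (n + 1) *ᵥ h) a) ^ 2
            * tdelta (towerTorus Lc M' (n + 1)) ((itRoot Lc M' rs hrs (n + 1) (wrapPt M' ((a.1 : Site (d + 1)) + unitVec a.2)) : ↥(pbox (towerTorus Lc M' (n + 1)))) : Site (d + 1)) s)
          * evalN Lc M' rs (n + 1) (fun s : ↥(pbox (towerTorus Lc M' (n + 1))) => (s : Site (d + 1))))
      = Matrix.fromCols
          (Matrix.of fun (a : ↥(pbox M') × Fin (d + 1)) (t : Res (toSite (rs 0)) Lc M') =>
            (c ^ 2 * (∏ i ∈ range (n + 1), (stepScale d Lc (lev (i + 1)) * ((box (d + 1) Lc).card : ℝ)))⁻¹)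
              * ((compRows Lc M' lev rs (n + 1) *ᵥ h) a) ^ 2 * tdelta M' ((a.1 : Site (d + 1)) + unitVec a.2) t.1)
          (0 : Matrix (↥(pbox M') × Fin (d + 1)) (NParam Lc (fine Lc M') (fun k => rs (k + 1)) n) ℝ) := by
    rw [of_tdelta_mul, evalN_succ]
    ext a e
    rcases e with t | e
    · simp only [Matrix.smul_apply, Matrix.of_apply, Matrix.fromCols_apply_inl, wrapPt_of_mem, smul_eq_mul]
      rw [bigRatio_eq_pow, quo_itRoot, tdelta_wrapPt]
      ring
    · simp only [Matrix.smul_apply, Matrix.of_apply, Matrix.fromCols_apply_inr, Matrix.zero_apply, wrapPt_of_mem, smul_eq_mul, itRoot_succ]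
      dsimp only [towerTorus_succ]
      rw [evalN_itRoot_rootPt, mul_zero, mul_zero]
  rw [hW₁, W₁_eq_neg_smul_tip_mul_evalN, hW₂, W₂_eq_smul_tip_mul_evalN, towerGen_eq_tgrad_mul_evalN Lc (n + 1) M' rs, Matrix.smul_mul, ← Matrix.mul_assoc,
    compIns₂_mul_tgrad Lc (n + 1) M' lev rs hrs h, ← hfar]
  simp only [Matrix.add_mul, Matrix.sub_mul, Matrix.smul_mul, Matrix.mul_smul, Matrix.mul_neg, smul_neg, smul_add, smul_sub, Matrix.mul_assoc, smul_smul]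
  module

end RowC2

/-! ## §2 The top step's coarse covariance row `d2` along the transported direction -/

section RowD2

variable {Lc} {M' : Fin (d + 1) → ℕ} [∀ μ, NeZero (M' μ)]

open Classical in
/-- [folklore] **THE PER-PAIR ENTRY OF THE TOP STEP's BI-MEMBER AGAINST THE RESIDUAL GAUGE COLUMNS** in ANY multiplier presentation `k ↦ (pμ′ k, inr (mμ′ k))` (`Lc ∣ M′`,
root `r ∈ box`, any level `ℓ`): PART 1's per-pair law with the far-root term OFF the residual columns (`tdelta_far_eq_zero_of_not_root` when the multiplier site is coarse,
`perZ_bhKStepAt_inr_inl_of_proj_ne` when it is not). -/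
theorem pair_mul_tgrad_res_apply {r : Fin (d + 1) → ℕ} (hr : r ∈ box (d + 1) Lc) (hM' : ∀ i, Lc ∣ M' i) (ℓ : ℕ)
    {κ : Type*} (pμ' : κ → ↥(pbox M')) (mμ' : κ → Fin (d + 1)) (b b' : ↥(pbox M') × Fin (d + 1)) (k : κ) (t : Res (toSite r) Lc M') :
    ((perF M' (dper M' (fun x z a c => ∑' n : Site (d + 1), (1 / 2 : ℝ) *
        (vh₂SAt (toSite r) Lc b.2 (b.1 : Site (d + 1)) b'.2 (translate M' (b'.1 : Site (d + 1)) n) x z a c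
          + vh₂SAt (toSite r) Lc b'.2 (translate M' (b'.1 : Site (d + 1)) n) b.2 (b.1 : Site (d + 1)) x z a c)))).submatrix
          (fun k : κ => ((pμ' k, Sum.inr (mμ' k)) : Idx M' (Fib d))) (fun c : ↥(pbox M') × Fin (d + 1) => ((c.1, Sum.inl c.2) : Idx M' (Fib d)))
        * (tgrad M').submatrix (fun a : ↥(pbox M') × Fin (d + 1) => ((a.1, Sum.inl a.2) : Idx M' (Fib d))) (fun t : Res (toSite r) Lc M' => (t.1 : ↥(pbox M')))) k t
      = tdelta M' ((b'.1 : Site (d + 1)) + unitVec b'.2) t.1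
            * perF M' (dper M' (vhSAt (toSite r) d Lc rfl b.2 (b.1 : Site (d + 1)))) (pμ' k, Sum.inr (mμ' k)) (b'.1, Sum.inl b'.2)
        + tdelta M' ((b.1 : Site (d + 1)) + unitVec b.2) t.1
            * perF M' (dper M' (vhSAt (toSite r) d Lc rfl b'.2 (b'.1 : Site (d + 1)))) (pμ' k, Sum.inr (mμ' k)) (b.1, Sum.inl b.2)
        - tdelta M' ((b.1 : Site (d + 1)) + unitVec b.2) t.1 * ((if b = b' then (1 : ℝ) else 0)
            * ((((Lc : ℝ) ^ (d + 1) * stepScale d Lc ℓ)⁻¹) * perF M' (bhKStepAt d (toSite r) Lc ℓ) (pμ' k, Sum.inr (mμ' k)) (b.1, Sum.inl b.2))) := by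
  have hL0 : 0 < Lc := Nat.pos_of_ne_zero (NeZero.ne Lc)
  have ht : Torus.proj Lc (((t.1 : ↥(pbox M')) : Site (d + 1)) - toSite r) ≠ 0 := (ne_rootOf_iff_proj_ne hL0 (toSite_mem_range hr) _).1 t.2
  -- PART 1's per-pair law at this presentation (stated in the goal's own letters; the lemma's slot maps agree by `rfl`)
  have h : ((perF M' (dper M' (fun x z a c => ∑' n : Site (d + 1), (1 / 2 : ℝ) *
        (vh₂SAt (toSite r) Lc b.2 (b.1 : Site (d + 1)) b'.2 (translate M' (b'.1 : Site (d + 1)) n) x z a c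
          + vh₂SAt (toSite r) Lc b'.2 (translate M' (b'.1 : Site (d + 1)) n) b.2 (b.1 : Site (d + 1)) x z a c)))).submatrix
          (fun k : κ => ((pμ' k, Sum.inr (mμ' k)) : Idx M' (Fib d))) (fun c : ↥(pbox M') × Fin (d + 1) => ((c.1, Sum.inl c.2) : Idx M' (Fib d)))
        * (tgrad M').submatrix (fun a : ↥(pbox M') × Fin (d + 1) => ((a.1, Sum.inl a.2) : Idx M' (Fib d))) (fun t : Res (toSite r) Lc M' => (t.1 : ↥(pbox M')))) k t
      = tdelta M' ((b'.1 : Site (d + 1)) + unitVec b'.2) t.1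
            * perF M' (dper M' (vhSAt (toSite r) d Lc rfl b.2 (b.1 : Site (d + 1)))) (pμ' k, Sum.inr (mμ' k)) (b'.1, Sum.inl b'.2)
        + tdelta M' ((b.1 : Site (d + 1)) + unitVec b.2) t.1
            * perF M' (dper M' (vhSAt (toSite r) d Lc rfl b'.2 (b'.1 : Site (d + 1)))) (pμ' k, Sum.inr (mμ' k)) (b.1, Sum.inl b.2)
        - tdelta M' ((b.1 : Site (d + 1)) + unitVec b.2) t.1 * ((if (b.2, (b.1 : Site (d + 1))) = (b'.2, (b'.1 : Site (d + 1))) then (1 : ℝ) else 0)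
            * ((((Lc : ℝ) ^ (d + 1) * stepScale d Lc ℓ)⁻¹) * perF M' (bhKStepAt d (toSite r) Lc ℓ) (pμ' k, Sum.inr (mμ' k)) (b.1, Sum.inl b.2)))
        + tdelta M' (((pμ' k : ↥(pbox M')) : Site (d + 1)) + toSite r + (Lc : ℤ) • unitVec (mμ' k)) t.1
            * (((((Lc : ℝ) ^ (d + 1) * stepScale d Lc ℓ)⁻¹) * perF M' (bhKStepAt d (toSite r) Lc ℓ) (pμ' k, Sum.inr (mμ' k)) (b.1, Sum.inl b.2))
              * ((((Lc : ℝ) ^ (d + 1) * stepScale d Lc ℓ)⁻¹) * perF M' (bhKStepAt d (toSite r) Lc ℓ) (pμ' k, Sum.inr (mμ' k)) (b'.1, Sum.inl b'.2))) :=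
    submatrix_borderT2_mul_tgrad (M := M') (M' := fun i => M' i / Lc) hr b'.2 (b'.1 : Site (d + 1)) (fun i => (Nat.mul_div_cancel' (hM' i)).symm)
      (V := fun κ u x z a c => ∑' n : Site (d + 1), (1 / 2 : ℝ) *
        (vh₂SAt (toSite r) Lc κ u b'.2 (translate M' (b'.1 : Site (d + 1)) n) x z a c + vh₂SAt (toSite r) Lc b'.2 (translate M' (b'.1 : Site (d + 1)) n) κ u x z a c))
      rfl b'.1.2 ℓ (fun k : κ => ((pμ' k : ↥(pbox M')) : Site (d + 1))) (fun k => (pμ' k).2) mμ' (fun t : Res (toSite r) Lc M' => (t.1 : ↥(pbox M'))) b.2 b.1 k t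
  rw [h, ite_bond_eq]
  by_cases hx : Torus.proj Lc ((pμ' k : ↥(pbox M')) : Site (d + 1)) = 0
  · rw [tdelta_far_eq_zero_of_not_root hM' (toSite r) hx (mμ' k) ht, zero_mul, add_zero]
  · simp only [perF_apply]
    rw [perZ_bhKStepAt_inr_inl_of_proj_ne (M := M') (toSite r) ℓ hx ((b.1 : ↥(pbox M')) : Site (d + 1)) (mμ' k) b.2,
      perZ_bhKStepAt_inr_inl_of_proj_ne (M := M') (toSite r) ℓ hx ((b'.1 : ↥(pbox M')) : Site (d + 1)) (mμ' k) b'.2]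
    ring

/-- [folklore] the finite algebra of the residual-column law: the two `b ↔ b′`-symmetric tip terms give `2·Σ_{b′} (Σ_b v b·P b b′)·(v b′·τ b′)`, the diagonal `−c·Σ_b q b·(v b·v b·τ b)`. -/
theorem bimember_res_algebra {β : Type*} [Fintype β] [DecidableEq β] (v τ q : β → ℝ) (P : β → β → ℝ) (c : ℝ) :
    (∑ b, ∑ b', v b * v b' * (τ b' * P b b' + τ b * P b' b - τ b * ((if b = b' then (1 : ℝ) else 0) * (c * q b))))
      = 2 * (∑ b', (∑ b, v b * P b b') * (v b' * τ b')) - c * (∑ b, q b * (v b * v b * τ b)) := by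
  have hd : ∀ b, ∑ b', v b * v b' * (τ b * ((if b = b' then (1 : ℝ) else 0) * (c * q b))) = c * (q b * (v b * v b * τ b)) := fun b => by
    rw [Finset.sum_eq_single b (fun b' _ hb' => by rw [if_neg (Ne.symm hb')]; ring) (fun hb => absurd (Finset.mem_univ b) hb), if_pos rfl]
    ring
  have e2 : ∑ b, ∑ b', v b * v b' * (τ b * P b' b) = ∑ b, ∑ b', v b * v b' * (τ b' * P b b') := by
    rw [Finset.sum_comm]
    exact Finset.sum_congr rfl fun b _ => Finset.sum_congr rfl fun b' _ => by ring
  have e3 : ∑ b', (∑ b, v b * P b b') * (v b' * τ b') = ∑ b, ∑ b', v b * v b' * (τ b' * P b b') := by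
    rw [Finset.sum_comm]
    refine Finset.sum_congr rfl fun b' _ => ?_
    rw [Finset.sum_mul]
    exact Finset.sum_congr rfl fun b _ => by ring
  simp only [mul_add, mul_sub, Finset.sum_add_distrib, Finset.sum_sub_distrib, hd, e2, e3, ← Finset.mul_sum]
  ring

/-- [folklore] **`bimember_mul_tgrad_res` — THE TOP STEP's WEIGHTED ♭ BI-MEMBER AGAINST THE TOP COMB's RESIDUAL GAUGE COLUMNS**, in ANY multiplier presentation
`k ↦ (pμ′ k, inr (mμ′ k))` (`Lc ∣ M′`, root `r ∈ box`, any level `ℓ` on the right): `(Σ_b Σ_{b′} (v b·v b′) • T^{b,b′}) · D̄ = 2 • ((Σ_b v b • M^{b}) · Tip(v)) − c_ℓ • (Q₂₀ · Tip(v⊙v))`,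
`Tip(v)(b, t̄) = v b·[t̄ = b.1 + e_{b.2}]` — PART 1's `stepIns₂_mul_tgrad` one level up with the far root off the residual columns (C2 §3's `sum_smul_vhSAt_mul_tgrad_res`, one order up). -/
theorem bimember_mul_tgrad_res {r : Fin (d + 1) → ℕ} (hr : r ∈ box (d + 1) Lc) (hM' : ∀ i, Lc ∣ M' i) (ℓ : ℕ)
    {κ : Type*} (pμ' : κ → ↥(pbox M')) (mμ' : κ → Fin (d + 1)) (v : ↥(pbox M') × Fin (d + 1) → ℝ) :
    (∑ b : ↥(pbox M') × Fin (d + 1), ∑ b' : ↥(pbox M') × Fin (d + 1), (v b * v b') •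
        (perF M' (dper M' (fun x z a c => ∑' n : Site (d + 1), (1 / 2 : ℝ) *
          (vh₂SAt (toSite r) Lc b.2 (b.1 : Site (d + 1)) b'.2 (translate M' (b'.1 : Site (d + 1)) n) x z a c
            + vh₂SAt (toSite r) Lc b'.2 (translate M' (b'.1 : Site (d + 1)) n) b.2 (b.1 : Site (d + 1)) x z a c)))).submatrix
          (fun k : κ => ((pμ' k, Sum.inr (mμ' k)) : Idx M' (Fib d))) (fun c : ↥(pbox M') × Fin (d + 1) => ((c.1, Sum.inl c.2) : Idx M' (Fib d))))
        * (tgrad M').submatrix (fun a : ↥(pbox M') × Fin (d + 1) => ((a.1, Sum.inl a.2) : Idx M' (Fib d))) (fun t : Res (toSite r) Lc M' => (t.1 : ↥(pbox M')))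
      = (2 : ℝ) • ((∑ b : ↥(pbox M') × Fin (d + 1), v b •
            (perF M' (dper M' (vhSAt (toSite r) d Lc rfl b.2 (b.1 : Site (d + 1))))).submatrix (fun k : κ => ((pμ' k, Sum.inr (mμ' k)) : Idx M' (Fib d)))
              (fun c : ↥(pbox M') × Fin (d + 1) => ((c.1, Sum.inl c.2) : Idx M' (Fib d))))
          * Matrix.of (fun (b : ↥(pbox M') × Fin (d + 1)) (t : Res (toSite r) Lc M') => v b * tdelta M' ((b.1 : Site (d + 1)) + unitVec b.2) t.1))
        - (((Lc : ℝ) ^ (d + 1) * stepScale d Lc ℓ)⁻¹) •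
          ((perF M' (bhKStepAt d (toSite r) Lc ℓ)).submatrix (fun k : κ => ((pμ' k, Sum.inr (mμ' k)) : Idx M' (Fib d)))
              (fun b : ↥(pbox M') × Fin (d + 1) => ((b.1, Sum.inl b.2) : Idx M' (Fib d)))
            * Matrix.of (fun (b : ↥(pbox M') × Fin (d + 1)) (t : Res (toSite r) Lc M') => (v b * v b) * tdelta M' ((b.1 : Site (d + 1)) + unitVec b.2) t.1)) := by
  ext k t
  have hL : ((∑ b : ↥(pbox M') × Fin (d + 1), ∑ b' : ↥(pbox M') × Fin (d + 1), (v b * v b') •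
        (perF M' (dper M' (fun x z a c => ∑' n : Site (d + 1), (1 / 2 : ℝ) *
          (vh₂SAt (toSite r) Lc b.2 (b.1 : Site (d + 1)) b'.2 (translate M' (b'.1 : Site (d + 1)) n) x z a c
            + vh₂SAt (toSite r) Lc b'.2 (translate M' (b'.1 : Site (d + 1)) n) b.2 (b.1 : Site (d + 1)) x z a c)))).submatrix
          (fun k : κ => ((pμ' k, Sum.inr (mμ' k)) : Idx M' (Fib d))) (fun c : ↥(pbox M') × Fin (d + 1) => ((c.1, Sum.inl c.2) : Idx M' (Fib d))))
        * (tgrad M').submatrix (fun a : ↥(pbox M') × Fin (d + 1) => ((a.1, Sum.inl a.2) : Idx M' (Fib d))) (fun t : Res (toSite r) Lc M' => (t.1 : ↥(pbox M')))) k t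
      = ∑ b : ↥(pbox M') × Fin (d + 1), ∑ b' : ↥(pbox M') × Fin (d + 1), v b * v b'
          * (tdelta M' ((b'.1 : Site (d + 1)) + unitVec b'.2) t.1
                * perF M' (dper M' (vhSAt (toSite r) d Lc rfl b.2 (b.1 : Site (d + 1)))) (pμ' k, Sum.inr (mμ' k)) (b'.1, Sum.inl b'.2)
            + tdelta M' ((b.1 : Site (d + 1)) + unitVec b.2) t.1
                * perF M' (dper M' (vhSAt (toSite r) d Lc rfl b'.2 (b'.1 : Site (d + 1)))) (pμ' k, Sum.inr (mμ' k)) (b.1, Sum.inl b.2)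
            - tdelta M' ((b.1 : Site (d + 1)) + unitVec b.2) t.1 * ((if b = b' then (1 : ℝ) else 0)
                * ((((Lc : ℝ) ^ (d + 1) * stepScale d Lc ℓ)⁻¹) * perF M' (bhKStepAt d (toSite r) Lc ℓ) (pμ' k, Sum.inr (mμ' k)) (b.1, Sum.inl b.2)))) := by
    rw [Matrix.sum_mul, Matrix.sum_apply]
    refine Finset.sum_congr rfl fun b _ => ?_
    rw [Matrix.sum_mul, Matrix.sum_apply]
    refine Finset.sum_congr rfl fun b' _ => ?_
    rw [Matrix.smul_mul, Matrix.smul_apply, smul_eq_mul, pair_mul_tgrad_res_apply hr hM' ℓ pμ' mμ' b b' k t]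
  rw [hL, bimember_res_algebra]
  simp only [Matrix.sub_apply, Matrix.smul_apply, Matrix.mul_apply, Matrix.of_apply, smul_eq_mul, Matrix.sum_apply, Matrix.submatrix_apply]

variable (Lc M') (lev : ℕ → ℕ) (rs : ℕ → (Fin (d + 1) → ℕ))

/-- [folklore] **`torus_d2_tower` — (COV-m) ORDER 2: THE TOP STEP's COARSE COVARIANCE ROW `d2` AT EVERY DEPTH, AS DISPLAYED IN #21 (`= 0`).**  With `Dbar := σ_{n+1} • D̄` (`c0`),
`Q₂₀` the door's `hQ₂₀` VERBATIM (level `lev 0`, root `rs 0`, presentation `(pμ′, mμ′)`), `D̄₁` (C2) and `D̄₂` (`torus_c2_tower`) the composite coarse jets, `Q₂₁` C2's `torus_d1_tower`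
letter (the top step's rooted first-order members along the direction TRANSPORTED ONE LEVEL UP, weight `c·θ_{n+1}`, `θ_{n+1} = Lc^{d+1}·stepScale d Lc (lev 0) ∕ σ_{n+1}`), and
**`Q₂₂ := c_{lev 0} • Σ_b Σ_{b′} ((cθ_{n+1}·(compRows·h)) b · (cθ_{n+1}·(compRows·h)) b′) •` the top step's ♭ BI-MEMBER `T^{b,b′}`** in the door's presentation (ONE summand — U23♭'s
shape; NO `Q₂₁`-member on an inner second jet): `Q₂₂·Dbar + 2•(Q₂₁·D̄₁) + Q₂₀·D̄₂ = 0` (§2's residual law: the tip terms cancel by `c_{lev 0}·σ·θ = 1`, the squared-weight terms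
by `c_{lev 0}·θ = σ⁻¹`). -/
theorem torus_d2_tower (hrs : ∀ k, rs k ∈ box (d + 1) Lc) (hM' : ∀ i, Lc ∣ M' i) (n : ℕ) (c : ℝ)
    (h : ↥(pbox (towerTorus Lc M' (n + 1))) × Fin (d + 1) → ℝ) {κ : Type*} (pμ' : κ → ↥(pbox M')) (mμ' : κ → Fin (d + 1)) :
    (((Lc : ℝ) ^ (d + 1) * stepScale d Lc (lev 0))⁻¹ •
        ∑ b : ↥(pbox M') × Fin (d + 1), ∑ b' : ↥(pbox M') × Fin (d + 1),
          (((c * (((Lc : ℝ) ^ (d + 1) * stepScale d Lc (lev 0)) * (∏ i ∈ range (n + 1), (stepScale d Lc (lev (i + 1)) * ((box (d + 1) Lc).card : ℝ)))⁻¹))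
              * (compRows Lc M' lev rs (n + 1) *ᵥ h) b)
            * ((c * (((Lc : ℝ) ^ (d + 1) * stepScale d Lc (lev 0)) * (∏ i ∈ range (n + 1), (stepScale d Lc (lev (i + 1)) * ((box (d + 1) Lc).card : ℝ)))⁻¹))
              * (compRows Lc M' lev rs (n + 1) *ᵥ h) b')) •
          (perF M' (dper M' (fun x z a e => ∑' m : Site (d + 1), (1 / 2 : ℝ) *
            (vh₂SAt (toSite (rs 0)) Lc b.2 (b.1 : Site (d + 1)) b'.2 (translate M' (b'.1 : Site (d + 1)) m) x z a e
              + vh₂SAt (toSite (rs 0)) Lc b'.2 (translate M' (b'.1 : Site (d + 1)) m) b.2 (b.1 : Site (d + 1)) x z a e)))).submatrix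
            (fun k : κ => ((pμ' k, Sum.inr (mμ' k)) : Idx M' (Fib d))) (fun e : ↥(pbox M') × Fin (d + 1) => ((e.1, Sum.inl e.2) : Idx M' (Fib d))))
        * ((∏ i ∈ range (n + 1), (stepScale d Lc (lev (i + 1)) * ((box (d + 1) Lc).card : ℝ))) •
            (tgrad M').submatrix (fun a : ↥(pbox M') × Fin (d + 1) => ((a.1, Sum.inl a.2) : Idx M' (Fib d))) (fun t : Res (toSite (rs 0)) Lc M' => (t.1 : ↥(pbox M'))))
      + (2 : ℝ) • ((∑ a' : ↥(pbox M') × Fin (d + 1),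
          ((c * (((Lc : ℝ) ^ (d + 1) * stepScale d Lc (lev 0)) * (∏ i ∈ range (n + 1), (stepScale d Lc (lev (i + 1)) * ((box (d + 1) Lc).card : ℝ)))⁻¹))
            * (compRows Lc M' lev rs (n + 1) *ᵥ h) a') •
          (perF M' (dper M' (vhSAt (toSite (rs 0)) d Lc rfl a'.2 (a'.1 : Site (d + 1))))).submatrix (fun k : κ => ((pμ' k, Sum.inr (mμ' k)) : Idx M' (Fib d)))
            (fun b : ↥(pbox M') × Fin (d + 1) => ((b.1, Sum.inl b.2) : Idx M' (Fib d))))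
          * Matrix.of (fun (a : ↥(pbox M') × Fin (d + 1)) (t : Res (toSite (rs 0)) Lc M') =>
              -(c * (compRows Lc M' lev rs (n + 1) *ᵥ h) a * tdelta M' ((a.1 : Site (d + 1)) + unitVec a.2) t.1)))
      + (perF M' (bhKStepAt d (toSite (rs 0)) Lc (lev 0))).submatrix (fun a : κ => ((pμ' a, Sum.inr (mμ' a)) : Idx M' (Fib d)))
          (fun b : ↥(pbox M') × Fin (d + 1) => ((b.1, Sum.inl b.2) : Idx M' (Fib d)))
        * Matrix.of (fun (a : ↥(pbox M') × Fin (d + 1)) (t : Res (toSite (rs 0)) Lc M') =>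
            (c ^ 2 * (∏ i ∈ range (n + 1), (stepScale d Lc (lev (i + 1)) * ((box (d + 1) Lc).card : ℝ)))⁻¹)
              * ((compRows Lc M' lev rs (n + 1) *ᵥ h) a) ^ 2 * tdelta M' ((a.1 : Site (d + 1)) + unitVec a.2) t.1)
      = 0 := by
  have hB : (box (d + 1) Lc).Nonempty := ⟨rs 0, hrs 0⟩
  have hσ := prod_stepScale_mul_card_ne_zero' Lc hB (fun i => lev (i + 1)) (n + 1)
  have hL : (Lc : ℝ) ^ (d + 1) * stepScale d Lc (lev 0) ≠ 0 := mul_ne_zero (pow_ne_zero _ (by exact_mod_cast NeZero.ne Lc)) (stepScale_ne_zero _)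
  -- abbreviations for the three scalars: `c₀ = c_{lev 0}`, `σ = σ_{n+1}`, `κ = c·θ_{n+1}`
  set c₀ : ℝ := ((Lc : ℝ) ^ (d + 1) * stepScale d Lc (lev 0))⁻¹ with hc₀
  set σ : ℝ := (∏ i ∈ range (n + 1), (stepScale d Lc (lev (i + 1)) * ((box (d + 1) Lc).card : ℝ))) with hσdef
  set kap : ℝ := c * (((Lc : ℝ) ^ (d + 1) * stepScale d Lc (lev 0)) * σ⁻¹) with hkap
  set v : ↥(pbox M') × Fin (d + 1) → ℝ := compRows Lc M' lev rs (n + 1) *ᵥ h with hv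
  -- `c₀·σ·κ = c` via `c₀ · (Lc^{d+1}·stepScale) = 1`, and `σ·σ⁻¹ = 1`
  have hunit : c₀ * ((Lc : ℝ) ^ (d + 1) * stepScale d Lc (lev 0)) = 1 := by rw [hc₀, inv_mul_cancel₀ hL]
  have hσinv : σ * σ⁻¹ = 1 := mul_inv_cancel₀ hσ
  have hk : c₀ * σ * kap = c := by
    rw [hkap, show c₀ * σ * (c * (((Lc : ℝ) ^ (d + 1) * stepScale d Lc (lev 0)) * σ⁻¹))
      = c * (c₀ * ((Lc : ℝ) ^ (d + 1) * stepScale d Lc (lev 0))) * (σ * σ⁻¹) by ring, hunit, hσinv]; ring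
  -- the weighted contact matrices as multiples of the unweighted ones
  have e1 : Matrix.of (fun (b : ↥(pbox M') × Fin (d + 1)) (t : Res (toSite (rs 0)) Lc M') => (kap * v b) * tdelta M' ((b.1 : Site (d + 1)) + unitVec b.2) t.1)
      = kap • Matrix.of (fun (b : ↥(pbox M') × Fin (d + 1)) (t : Res (toSite (rs 0)) Lc M') => v b * tdelta M' ((b.1 : Site (d + 1)) + unitVec b.2) t.1) := by
    ext b t; simp only [Matrix.of_apply, Matrix.smul_apply, smul_eq_mul, mul_assoc]
  have e2 : Matrix.of (fun (b : ↥(pbox M') × Fin (d + 1)) (t : Res (toSite (rs 0)) Lc M') => ((kap * v b) * (kap * v b)) * tdelta M' ((b.1 : Site (d + 1)) + unitVec b.2) t.1)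
      = (kap * kap) • Matrix.of (fun (b : ↥(pbox M') × Fin (d + 1)) (t : Res (toSite (rs 0)) Lc M') => (v b * v b) * tdelta M' ((b.1 : Site (d + 1)) + unitVec b.2) t.1) := by
    ext b t; simp only [Matrix.of_apply, Matrix.smul_apply, smul_eq_mul]; ring
  have e3 : Matrix.of (fun (a : ↥(pbox M') × Fin (d + 1)) (t : Res (toSite (rs 0)) Lc M') => -(c * v a * tdelta M' ((a.1 : Site (d + 1)) + unitVec a.2) t.1))
      = -(c • Matrix.of (fun (b : ↥(pbox M') × Fin (d + 1)) (t : Res (toSite (rs 0)) Lc M') => v b * tdelta M' ((b.1 : Site (d + 1)) + unitVec b.2) t.1)) := by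
    ext a t; simp only [Matrix.of_apply, Matrix.neg_apply, Matrix.smul_apply, smul_eq_mul, mul_assoc]
  have e4 : Matrix.of (fun (a : ↥(pbox M') × Fin (d + 1)) (t : Res (toSite (rs 0)) Lc M') => (c ^ 2 * σ⁻¹) * (v a) ^ 2 * tdelta M' ((a.1 : Site (d + 1)) + unitVec a.2) t.1)
      = (c ^ 2 * σ⁻¹) • Matrix.of (fun (b : ↥(pbox M') × Fin (d + 1)) (t : Res (toSite (rs 0)) Lc M') => (v b * v b) * tdelta M' ((b.1 : Site (d + 1)) + unitVec b.2) t.1) := by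
    ext a t; simp only [Matrix.of_apply, Matrix.smul_apply, smul_eq_mul, sq, mul_assoc]
  -- the weighted first-order members as `κ •` the `v`-weighted ones
  have e5 : (∑ a' : ↥(pbox M') × Fin (d + 1), (kap * v a') •
          (perF M' (dper M' (vhSAt (toSite (rs 0)) d Lc rfl a'.2 (a'.1 : Site (d + 1))))).submatrix (fun k : κ => ((pμ' k, Sum.inr (mμ' k)) : Idx M' (Fib d)))
            (fun b : ↥(pbox M') × Fin (d + 1) => ((b.1, Sum.inl b.2) : Idx M' (Fib d))))
      = kap • ∑ a' : ↥(pbox M') × Fin (d + 1), v a' •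
          (perF M' (dper M' (vhSAt (toSite (rs 0)) d Lc rfl a'.2 (a'.1 : Site (d + 1))))).submatrix (fun k : κ => ((pμ' k, Sum.inr (mμ' k)) : Idx M' (Fib d)))
            (fun b : ↥(pbox M') × Fin (d + 1) => ((b.1, Sum.inl b.2) : Idx M' (Fib d))) := by
    rw [Finset.smul_sum]
    exact Finset.sum_congr rfl fun a' _ => by rw [smul_smul]
  rw [Matrix.mul_smul, Matrix.smul_mul, bimember_mul_tgrad_res (hrs 0) hM' (lev 0) pμ' mμ' (fun b => kap * v b), e1, e2, e3, e4, e5]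
  simp only [Matrix.smul_mul, Matrix.mul_smul, Matrix.mul_neg, smul_sub, smul_neg, smul_smul]
  match_scalars <;> first
    | linear_combination ((2 : ℝ) * kap) * hk
    | linear_combination (-(c + c₀ * σ * kap) * σ⁻¹) * hk + (c₀ ^ 2 * kap ^ 2 * σ) * hσinv

end RowD2

end Summit.QuantumFields.BalabanUV.Beta.FP.TorusCompositeCovarianceTwoRows

end
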